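import Summits.QuantumFields.YangMills.Theses.UnitScaleTilt

/-!
# Route `UnitScaleTilt` — the GLUE of crux K1's split: `MinimiserStability → FluctuationComparison → UnitTilt`
# (item stmt-QuantumFields-19824 `UnitTiltOfMinimiserFluctuation`, CLOSED by this file)

Cell `ym3-torus` (HUMAN RULING D-0037, YM ladder rung R3), seat `ym3-torus-p1` gen 4.  The two layer-2 children of `UnitTilt`
(stmt-QuantumFields-19822 `MinimiserStability`, -19823 `FluctuationComparison`; route rev 1) are stated «eventually in the free top
fraction» (`∃ m₀, ∀ m ≥ m₀`) with their own thresholds `γ₁`; at the common `m := max (max m₀¹ m₀²) 1 > 0` and `γ₁ := min γ₁¹ γ₁²`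
the tree theorem `T3ConstrainedMinimiser.unitTiltAt_of_minimiser_fluctuation` (p408691: subtract the minimiser comparison from the
fluctuation comparison, exponentiate, descend the tilt to the unit lattice) gives `UnitTiltAt F γ b₀ p₀ m`, i.e. the parent `UnitTilt`.
Proof text = the planner's certified glue (HOME/route-R3/ym/split/SketchSplit.lean, farm rc 0) transcribed against the tree's
route file.  WHAT THIS IS NOT: neither child is proved here; K1 stays open.
-/

noncomputable section

open Literature.MathematicalPhysics.QuantumFieldTheory.Balaban1983to89
open Literature.MathematicalPhysics.QuantumFieldTheory.Balaban1983to89.T3ContinuumYM3Torus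
open Summit.QuantumFields.YangMills.Theses.UnitScaleTilt

namespace Summit.QuantumFields.YangMills.Theorems

/-- **THE GLUE** `MinimiserStability → FluctuationComparison → UnitTilt`: at `m := max (max m₀¹ m₀²) 1` and `γ₁ := min γ₁¹ γ₁²` both
children apply, and `T3ConstrainedMinimiser.unitTiltAt_of_minimiser_fluctuation` composes them into `UnitTiltAt` (`0 < γ` gives the
`0 ≤ γ` it needs).  Closes item stmt-QuantumFields-19824. -/
theorem unitTiltOfMinimiserFluctuation_proof : UnitTiltOfMinimiserFluctuation := by
  intro h₁ h₂ L
  obtain ⟨m₁, hm₁⟩ := h₁ L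
  obtain ⟨m₂, hm₂⟩ := h₂ L
  refine ⟨max (max m₁ m₂) 1, lt_of_lt_of_le Nat.one_pos (le_max_right _ _), fun b₀ p₀ hb hp => ?_⟩
  obtain ⟨γ₁, hγ₁, hA⟩ := hm₁ _ ((le_max_left _ _).trans (le_max_left _ _)) b₀ p₀ hb hp
  obtain ⟨γ₂, hγ₂, hB⟩ := hm₂ _ ((le_max_right _ _).trans (le_max_left _ _)) b₀ p₀ hb hp
  refine ⟨min γ₁ γ₂, lt_min hγ₁ hγ₂, fun F γ hL hγ hle => ?_⟩
  exact T3ConstrainedMinimiser.unitTiltAt_of_minimiser_fluctuation F hγ.le b₀ p₀ _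
    (hA F γ hL hγ (hle.trans (min_le_left _ _))) (hB F γ hL hγ (hle.trans (min_le_right _ _)))

end Summit.QuantumFields.YangMills.Theorems

end
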